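import Summits.QuantumFields.YangMills.Theorems.IR.AfPincerUcFormat
import Summits.QuantumFields.YangMills.Theorems.IR.AfPincerUcPortEngine
import Summits.QuantumFields.YangMills.Theorems.IR.AfPincerUcPortTorus

/-!
# `stub_typCriterionUc : TypCriterionUKPc` — the typical-data criterion E^{Uc} of the line `af-pincer-Uc` (crux `IR`,
# item stmt-QuantumFields-19354, route-QuantumFields-BalabanLadder), PROVED

This file closes the registered stub `stub_typCriterionUc : TypCriterionUKPc` of the slot of record `af-pincer-Uc`
(route owner ym-beyond-p2, R65/R72; skeleton sha16 b6e69d9662b5b07a; tree constants `Theorems.IR.AfPincerUcFormat`) BY NAME: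
`Summit.QuantumFields.YangMills.Cruxes.IR.AfPincerUc.stub_typCriterionUc`.  It is a `--supports` proof for the crux item (it does
not close `IR`; the other two stubs `stub_onsetUc`, `stub_afOnsetUc` are research).

Statement (E^{Uc}, group-blind): for every admissible `(n, ε)` (`1 ≤ n`, `0 ≤ ε`, `ε · M(n) ≤ 3/4`) there are `δ₀, κ > 0`, `s₀`
such that for every compact `G`, faithful unitary continuous `ρ`, observables `A, B`, one constant `C` gives: whenever the
format `TypShellCondUKPc ρ β b n ε δ` holds at mesh `b` with `0 < δ ≤ δ₀` — per frame ONE cell-local family `Typ` with clause (i)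
AT EVERY CENTRE, clause (ii) in uniform-kernel-Peierls form, clause (iii) — connected correlations on the tori of side
`2S+1 ≥ s₀ b` decay like `C e^{−κ t / b}`.

Proof = architecture δ' of the crux-ideate memo `MEMO-g6-port-map.md` (seat ym-cruxidea-19354-1 g6; `Sketch-g6-port.lean`), a PORT
of the tree's coarse-cell defect engine:
* `Port.box_uniform_influence` (`Theorems.IR.AfPincerUcPortEngine`): clauses (i)+(ii) for the uniform mesh-`b` frame give, via
  the box specification with typical padding and phantom layers (`AfPincerUcPortBoxDefs`, obligations P1–P4 in
  `AfPincerUcPortSpec/GoodFS/Peierls`) and `Literature.Probability.LatticeModels.uniform_influence_markov_defects`, a per-box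
  uniform two-exterior influence bound for the `ℤ⁴` Wilson kernels;
* `Port.torus_clustering_of_box_influence` (`Theorems.IR.AfPincerUcPortTorus`): that bound gives clustering on the tori
  (route-8895's far-factor DLR transfer);
* here: typical padding exists under clause (ii) with `δ < 1` (`Port.exists_typical_pad`), `T2Space`/`SecondCountableTopology`
  from `ρ` faithful, the mesh-`b` uniform frame is a frame, quantifier plumbing; `δ₀ := min q₀ (1/2)`, `s₀ := 1`.
Clause (iii) (torus anchor) is not used.

HONEST FRAMING: one stub (the PORT, «M») of one open gap-crux of a CONDITIONAL chain (Track A 0/28 UV) — the crux's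
difficulty lives in `stub_onsetUc`; nothing here is progress on the gap, infinite volume or Clay.
-/

set_option autoImplicit false

noncomputable section

open MeasureTheory
open scoped ENNReal
open Literature.MathematicalPhysics.QuantumFieldTheory Literature.MathematicalPhysics.QuantumLattice
open Literature.Probability.LatticeModels
open Summit.QuantumFields.YangMills.Cruxes.IR.Tempered (cellEdges regionEdges)
open Summit.QuantumFields.YangMills.Cruxes.IR.CellTempered.Engine (frameCell frameCell_eq_iff)

namespace Summit.QuantumFields.YangMills.Cruxes.IR.AfPincerUc

/-! ## Typical padding exists (crux-ideate `Sketch-g6-port.lean` §5, verbatim up to the namespace and an inlined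
`padConfig`) -/

namespace Port

variable {G : Type} [Group G] [TopologicalSpace G] [IsTopologicalGroup G] [CompactSpace G]
  [MeasurableSpace G] [BorelSpace G]

omit [IsTopologicalGroup G] [CompactSpace G] [BorelSpace G] in
/-- A mesh-`b` frame with `b ≥ 1` has steps `≥ 1`. -/
theorem isFrame_step {b : ℕ} {w : Fin 4 → ℤ → ℤ} (hb : 1 ≤ b) (hw : IsFrame b w) :
    ∀ i j, w i j + 1 ≤ w i (j + 1) := by
  intro i j
  have h := (hw i j).1
  have hb' : (1 : ℤ) ≤ ((b : ℕ) : ℤ) := by exact_mod_cast hb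
  linarith

omit [Group G] [TopologicalSpace G] [IsTopologicalGroup G] [CompactSpace G] [BorelSpace G] in
/-- **Cellwise gluing of typical data is typical everywhere** (`Typ c` reads only the cell's own edges). -/
theorem glue_mem {b : ℕ} {w : Fin 4 → ℤ → ℤ} (hb : 1 ≤ b) (hw : IsFrame b w)
    {Typ : (Fin 4 → ℤ) → Set (LGConfig 4 G)} (hloc : TypLocal w Typ) {u : (Fin 4 → ℤ) → LGConfig 4 G}
    (hu : ∀ c, u c ∈ Typ c) (c : Fin 4 → ℤ) : (fun e => u (frameCell w e) e) ∈ Typ c := by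
  have heq : ∀ e ∈ (↑(cellEdges w c) : Set (Literature.MathematicalPhysics.QuantumLattice.ZdEdge 4)),
      (fun e => u (frameCell w e) e) e = u c e := by
    intro e he
    have hc : frameCell w e = c := (frameCell_eq_iff (isFrame_step hb hw) e c).2 (Finset.mem_coe.1 he)
    simp only [hc]
  have h : ((fun e => u (frameCell w e) e) ∈ Typ c) = (u c ∈ Typ c) := hloc.2 c heq
  rw [h]
  exact hu c

/-- **Under the UKP clause with `δ < 1` every `Typ c` is nonempty** (take `F := {c}`, `F'` := the `3⁴` cells around `c`,
any exterior: the kernel is a probability measure and charges «`c` atypical» at most `δ < 1`). -/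
theorem typ_nonempty_of_clauseII [SecondCountableTopology G] {N : ℕ} {ρ : G →* Matrix (Fin N) (Fin N) ℂ}
    (hρ : Continuous ρ) {β : ℝ} {w : Fin 4 → ℤ → ℤ} {δ : ℝ} {Typ : (Fin 4 → ℤ) → Set (LGConfig 4 G)}
    (hII : ClauseIIukp ρ β w δ Typ) (hδ : δ < 1) (c : Fin 4 → ℤ) : (Typ c).Nonempty := by
  classical
  by_contra hempty
  rw [Set.not_nonempty_iff_eq_empty] at hempty
  set F' : Finset (Fin 4 → ℤ) := Fintype.piFinset fun i : Fin 4 => Finset.Icc (c i - 1) (c i + 1) with hF'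
  have hcF' : c ∈ F' := by
    simp only [hF', Fintype.mem_piFinset, Finset.mem_Icc]
    intro i; constructor <;> linarith
  have hsub : ({c} : Finset (Fin 4 → ℤ)) ⊆ F' := Finset.singleton_subset_iff.2 hcF'
  set ζ : LGConfig 4 G := fun _ => 1 with hζ
  have hprem : ∀ c₁ ∈ ({c} : Finset (Fin 4 → ℤ)), ∀ c' : Fin 4 → ℤ, (∀ i, |c' i - c₁ i| ≤ 1) →
      c' ∈ F' ∨ ζ ∈ Typ c' := by
    intro c₁ hc₁ c' hc'
    rw [Finset.mem_singleton] at hc₁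
    subst hc₁
    left
    simp only [hF', Fintype.mem_piFinset, Finset.mem_Icc]
    intro i
    have h := hc' i
    rw [abs_le] at h
    constructor <;> linarith
  have hle := hII {c} F' hsub (Finset.singleton_nonempty c) ζ hprem
  haveI := isProbabilityMeasure_ymSpecification (d := 4) ρ hρ β (regionEdges w F') ζ
  have huniv : {σ : LGConfig 4 G | ∀ c₁ ∈ ({c} : Finset (Fin 4 → ℤ)), σ ∉ Typ c₁} = Set.univ := by
    ext σ
    simp [hempty]
  rw [huniv, measure_univ, Finset.card_singleton, pow_one] at hle
  have h1 : (1 : ℝ≥0∞) ≤ ENNReal.ofReal δ := hle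
  have : (1 : ℝ) ≤ δ := by
    by_contra hlt
    rw [not_le] at hlt
    have : ENNReal.ofReal δ < 1 := by
      rw [← ENNReal.ofReal_one]
      exact (ENNReal.ofReal_lt_ofReal_iff zero_lt_one).2 hlt
    exact absurd h1 (not_le.2 this)
  linarith

/-- Hence, under the hypotheses of the port, TYPICAL PADDING exists: some `pad` is typical on every `ℤ⁴` cell. -/
theorem exists_typical_pad [SecondCountableTopology G] {N : ℕ} {ρ : G →* Matrix (Fin N) (Fin N) ℂ}
    (hρ : Continuous ρ) {β : ℝ} {b : ℕ}
    {w : Fin 4 → ℤ → ℤ} (hb : 1 ≤ b) (hw : IsFrame b w) {δ : ℝ} {Typ : (Fin 4 → ℤ) → Set (LGConfig 4 G)}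
    (hloc : TypLocal w Typ) (hII : ClauseIIukp ρ β w δ Typ) (hδ : δ < 1) :
    ∃ pad : LGConfig 4 G, ∀ c, pad ∈ Typ c := by
  choose u hu using fun c => typ_nonempty_of_clauseII hρ hII hδ c
  exact ⟨fun e => u (frameCell w e) e, glue_mem hb hw hloc hu⟩

/-- The uniform mesh-`b` grid `j ↦ b j` is a mesh-`b` frame. -/
theorem isFrame_uniform (b : ℕ) : IsFrame b (fun _ j => ((b : ℕ) : ℤ) * j) := by
  intro i j
  have hb0 : (0 : ℤ) ≤ ((b : ℕ) : ℤ) := Nat.cast_nonneg b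
  constructor <;> nlinarith

end Port

/-! ## The stub -/

/-- **stub E^{Uc} — the typical-data criterion of the line `af-pincer-Uc`, PROVED** (registered stub `stub_typCriterionUc` of
crux `IR`, item stmt-QuantumFields-19354; the PORT of the tree's coarse-cell defect engine under architecture δ' of the
crux-ideate memo `MEMO-g6-port-map.md`): admissible `(n, ε)` give `δ₀, κ > 0`, `s₀` such that `TypShellCondUKPc ρ β b n ε δ` at
`0 < δ ≤ δ₀` implies clustering at rate `κ / b` on every torus of side `≥ s₀ b`, with a constant depending on `A, B` only.
See the module docstring for the proof map. -/
theorem stub_typCriterionUc : TypCriterionUKPc := by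
  intro n ε _hn hε hM
  have hM' : ε * (Literature.Probability.LatticeModels.shellCount 4 n : ℝ) ≤ 3 / 4 := hM
  obtain ⟨δ₀, θ, C₁, hδ₀, hθ, hθ1, hC₁, hbox⟩ := Port.box_uniform_influence n ε hε hM'
  obtain ⟨κ, hκ, hclus⟩ := Port.torus_clustering_of_box_influence θ C₁ hθ hθ1 hC₁
  refine ⟨min δ₀ (1 / 2), κ, 1, lt_min hδ₀ one_half_pos, hκ, ?_⟩
  intro G _ _ _ _ _ _ N ρ hρc hρi _hρu A B
  haveI : T2Space G := (hρc.isClosedEmbedding hρi).isEmbedding.t2Space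
  haveI : SecondCountableTopology G := (hρc.isClosedEmbedding hρi).isEmbedding.secondCountableTopology
  obtain ⟨C, hC⟩ := hclus ρ hρc A B
  refine ⟨C, ?_⟩
  intro β b hb δ hδ hδ₀' hcond S _hS t ht
  refine hC β b hb ?_ S t ht
  -- the per-box influence bound for the uniform frame, from the format
  intro x₀ m hm Δf hΔf D hD f hfS hfm hf01 η η'
  have hwF : IsFrame b (fun _ j => ((b : ℕ) : ℤ) * j) := Port.isFrame_uniform b
  obtain ⟨Typ, hloc, hI, hII, -⟩ := hcond _ hwF
  have hδ1 : δ < 1 := lt_of_le_of_lt (hδ₀'.trans (min_le_right _ _)) one_half_lt_one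
  obtain ⟨pad, hpad⟩ := Port.exists_typical_pad hρc hb hwF hloc hII hδ1
  exact hbox ρ hρc β _ (Port.isFrame_step hb hwF) Typ pad δ hloc.1 hloc.2 hI hII hpad hδ.le
    (hδ₀'.trans (min_le_left _ _)) x₀ m hm Δf hΔf D hD f hfS hfm hf01 η η'

end Summit.QuantumFields.YangMills.Cruxes.IR.AfPincerUc

end
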